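import Mathlib
import Literature.NumberTheory.LFunctions.Zhang2022.SkeletonMeanValue
import HarnessLib

/-!
# Zhang (2022) §7, proof of Proposition 7.1 part (c): the elementary identities (7.17),
# `λ₀ⱼ(drn) = λ₀ⱼ(dr)λ̃₀ⱼ(n,dr)`, and the support clause — DISCHARGED

Topic `Literature/NumberTheory/LFunctions/Zhang2022` (Landau–Siegel audit tree; verdict-neutral).
Y. Zhang, *Discrete mean estimates and the Landau–Siegel zero*, arXiv:2211.02515v1 (2022)
[Zhang2022LandauSiegel] — **an unrefereed manuscript under adjudication**. D-0069 campaign, cell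
`siegel-zhang`, DISCHARGE of the purely algebraic steps of "*Proof of Proposition 7.1: The main
term*" (§7 pp. 39–42, tex L2063–L2178), typed statement-exact by slice L2-t5 as
`Section7dStatements.Step7u042 / Eq717 / Step7u044 / Step7u056 / Step7u057` (proposal p412033).
This file PROVES those five claims, stated here with the typed `Prop` bodies UNFOLDED (theorems
only, no new definitions; the one-line bridges `step7u0NN_holds : Step7u0NN c'` follow once the
statement file lands):

| DAG node | typed decl (L2-t5) | theorem here | content |
|---|---|---|---|
| `Z22:§7.u042` | `Step7u042 c'` | `conv_eq_sum_fiber_gcd` | `(κ∗a₁)(dl) = Σ_{d₁∣d} Σ_{m₁m₂=dl,(m₁,d)=d₁} κ(m₁)a₁(m₂)` |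
| `Z22:(7.17)` | `Eq717 c'` | `conv_eq_sum_divisors_coprime` | `(κ∗a₁)(dl) = Σ_{d=d₁d₂} Σ_{l=l₁l₂,(l₁,d₂)=1} κ(d₁l₁)a₁(d₂l₂)` |
| `Z22:§7.u044` | `Step7u044` | `adm72_support` | `d₂l₂ ≥ PT⁻² ⇒ a₁(d₂l₂) = 0`, `d₁d₂k ≥ PT⁻² ⇒ a₂(d₁d₂k) = 0` |
| `Z22:§7.u056` | `Step7u056 c'` | `lamZero_mul_eq` | `λ₀ⱼ(drn) = λ₀ⱼ(dr)λ̃₀ⱼ(n,dr)` |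
| `Z22:§7.u057` | `Step7u057 c'` | `lamZero_mul_sum_eq_xiZero` | `λ₀ⱼ(drn)Σ_{n=d₁k₁,(k₁,r)=1}… = λ₀ⱼ(dr)ξ₀ⱼ(n;d,r)` |

All objects are the banked skeleton's (`Skeleton.kappaZ`, `Skeleton.lamZero`, `Skeleton.lamTildeZero`,
`Skeleton.xiZero`, `Skeleton.kappaTildeZero`, `Skeleton.Adm72`, `MeanSquareMajorant.conv`). The first
two identities hold for an ARBITRARY arithmetic function in place of `κ` (stated so). 0 new facts.

WHAT THIS IS NOT: any claim about Theorems 1–2 of the manuscript or about Landau–Siegel zeros; not a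
discharge of Proposition 7.1 — only of five algebraic steps inside its printed proof.

## References

* Y. Zhang, arXiv:2211.02515v1 (2022), §7 pp. 39–41, (7.17) and the displays at tex L2074, L2097,
  L2156, L2160. [cite: Zhang2022LandauSiegel, §7 pp. 39–41]
-/

noncomputable section

open Finset

namespace Literature.NumberTheory.LFunctions.Zhang2022.Section7MainTerm

open Literature.NumberTheory.LFunctions.Zhang2022.Skeleton
open ArithmeticFunction (moebius)

/-! ## `Z22:§7.u042`: grouping the divisor pairs of `dl` by `d₁ = (m₁, d)` -/

/-- `Z22:§7.u042` DISCHARGED (for any arithmetic function `κ`). "Since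
`(κ ∗ a₁)(dl) = Σ_{m₁m₂=dl} κ(m₁)a₁(m₂) = Σ_{d=d₁d₂} Σ_{m₁m₂=dl, (m₁,d)=d₁} κ(m₁)a₁(m₂)`" (§7 p. 39):
the divisor pairs of `dl` are partitioned according to the value of `gcd(m₁, d) ∈ divisors d`.
[cite: Zhang2022LandauSiegel, §7 p.39, tex L2074] -/
theorem conv_eq_sum_fiber_gcd (κ : ArithmeticFunction ℂ) (a₁ : ℕ → ℂ) (d l : ℕ) (hd : 0 < d) :
    MeanSquareMajorant.conv κ a₁ (d * l) =
      ∑ d₁ ∈ d.divisors,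
        ∑ x ∈ (d * l).divisorsAntidiagonal.filter (fun x => Nat.gcd x.1 d = d₁), κ x.1 * a₁ x.2 := by
  unfold MeanSquareMajorant.conv
  symm
  apply Finset.sum_fiberwise_of_maps_to
  intro x _
  exact Nat.mem_divisors.mpr ⟨Nat.gcd_dvd_right _ _, hd.ne'⟩

/-! ## `Z22:(7.17)`: the substitution `m₁ = d₁l₁`, `m₂ = d₂l₂` -/

/-- The fibre over `d₁ ∣ d` of the divisor pairs of `dl`, re-parametrised by `l = l₁l₂` with
`(l₁, d/d₁) = 1`: `Σ_{m₁m₂=dl, (m₁,d)=d₁} κ(m₁)a₁(m₂) = Σ_{l₁l₂=l, (l₁,d/d₁)=1} κ(d₁l₁)a₁((d/d₁)l₂)`.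
[cite: Zhang2022LandauSiegel, §7 (7.17) p.39, tex L2078] -/
theorem sum_fiber_gcd_eq (κ : ArithmeticFunction ℂ) (a₁ : ℕ → ℂ) {d l d₁ : ℕ} (hd : 0 < d)
    (hl : 0 < l) (hd₁ : d₁ ∈ d.divisors) :
    ∑ x ∈ (d * l).divisorsAntidiagonal.filter (fun x => Nat.gcd x.1 d = d₁), κ x.1 * a₁ x.2 =
      ∑ x ∈ l.divisorsAntidiagonal.filter (fun x => Nat.Coprime x.1 (d / d₁)),
        κ (d₁ * x.1) * a₁ (d / d₁ * x.2) := by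
  obtain ⟨hd₁d, -⟩ := Nat.mem_divisors.mp hd₁
  obtain ⟨d₂, rfl⟩ := hd₁d
  have hd₁ : 0 < d₁ := Nat.pos_of_mul_pos_right hd
  have hd₂ : 0 < d₂ := Nat.pos_of_mul_pos_left hd
  have hdiv : d₁ * d₂ / d₁ = d₂ := Nat.mul_div_cancel_left d₂ hd₁
  rw [hdiv]
  -- decoding a member of the fibre: `x = (d₁l₁, d₂l₂)` with `(l₁,d₂) = 1`, `l₁l₂ = l`
  have decode : ∀ x ∈ (d₁ * d₂ * l).divisorsAntidiagonal.filter (fun x => Nat.gcd x.1 (d₁ * d₂) = d₁),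
      ∃ l₁ l₂ : ℕ, x = (d₁ * l₁, d₂ * l₂) ∧ Nat.Coprime l₁ d₂ ∧ l₁ * l₂ = l := by
    intro x hx
    rw [Finset.mem_filter, Nat.mem_divisorsAntidiagonal] at hx
    obtain ⟨⟨hx12, -⟩, hgcd⟩ := hx
    have h1 : d₁ ∣ x.1 := hgcd ▸ Nat.gcd_dvd_left _ _
    obtain ⟨l₁, hl₁⟩ := h1
    have hcop : Nat.Coprime l₁ d₂ := by
      have h0 : 0 < Nat.gcd x.1 (d₁ * d₂) := by rw [hgcd]; exact hd₁
      have := Nat.coprime_div_gcd_div_gcd (m := x.1) (n := d₁ * d₂) h0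
      rwa [hgcd, hl₁, Nat.mul_div_cancel_left _ hd₁, Nat.mul_div_cancel_left _ hd₁] at this
    have hx12' : x.2 * l₁ = d₂ * l := by
      have : d₁ * (x.2 * l₁) = d₁ * (d₂ * l) := by
        calc d₁ * (x.2 * l₁) = d₁ * l₁ * x.2 := by ring
          _ = x.1 * x.2 := by rw [hl₁]
          _ = d₁ * d₂ * l := hx12
          _ = d₁ * (d₂ * l) := by ring
      exact Nat.eq_of_mul_eq_mul_left hd₁ this
    have h2 : d₂ ∣ x.2 := hcop.symm.dvd_of_dvd_mul_right (Dvd.intro l hx12'.symm)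
    obtain ⟨l₂, hl₂⟩ := h2
    refine ⟨l₁, l₂, ?_, hcop, ?_⟩
    · ext <;> simp [hl₁, hl₂]
    · have : d₂ * (l₁ * l₂) = d₂ * l := by
        calc d₂ * (l₁ * l₂) = d₂ * l₂ * l₁ := by ring
          _ = x.2 * l₁ := by rw [hl₂]
          _ = d₂ * l := hx12'
      exact Nat.eq_of_mul_eq_mul_left hd₂ this
  symm
  refine Finset.sum_bij' (fun x _ => (d₁ * x.1, d₂ * x.2)) (fun x _ => (x.1 / d₁, x.2 / d₂))
    ?_ ?_ ?_ ?_ ?_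
  · -- maps into the fibre
    intro x hx
    rw [Finset.mem_filter, Nat.mem_divisorsAntidiagonal] at hx
    obtain ⟨⟨hx12, -⟩, hcop⟩ := hx
    rw [Finset.mem_filter, Nat.mem_divisorsAntidiagonal]
    refine ⟨⟨?_, ?_⟩, ?_⟩
    · rw [← hx12]; ring
    · positivity
    · rw [Nat.gcd_mul_left, hcop.gcd_eq_one, mul_one]
  · -- inverse maps into the re-parametrised set
    intro x hx
    obtain ⟨l₁, l₂, rfl, hcop, hl₁₂⟩ := decode x hx
    rw [Finset.mem_filter, Nat.mem_divisorsAntidiagonal]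
    simp only [Nat.mul_div_cancel_left _ hd₁, Nat.mul_div_cancel_left _ hd₂]
    exact ⟨⟨hl₁₂, hl.ne'⟩, hcop⟩
  · -- left inverse
    intro x _
    simp only [Nat.mul_div_cancel_left _ hd₁, Nat.mul_div_cancel_left _ hd₂]
  · -- right inverse
    intro x hx
    obtain ⟨l₁, l₂, rfl, -, -⟩ := decode x hx
    simp only [Nat.mul_div_cancel_left _ hd₁, Nat.mul_div_cancel_left _ hd₂]
  · -- values agree
    intro x _
    rfl

/-- `Z22:(7.17)` DISCHARGED (for any arithmetic function `κ`). "it follows, by substituting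
`m₁ = d₁l₁`, that `(κ ∗ a₁)(dl) = Σ_{d=d₁d₂} Σ_{l=l₁l₂, (l₁,d₂)=1} κ(d₁l₁)a₁(d₂l₂)` (7.17)" (§7 p. 39).
[cite: Zhang2022LandauSiegel, §7 (7.17) p.39, tex L2078] -/
theorem conv_eq_sum_divisors_coprime (κ : ArithmeticFunction ℂ) (a₁ : ℕ → ℂ) (d l : ℕ)
    (hd : 0 < d) (hl : 0 < l) :
    MeanSquareMajorant.conv κ a₁ (d * l) =
      ∑ d₁ ∈ d.divisors,
        ∑ x ∈ l.divisorsAntidiagonal.filter (fun x => Nat.Coprime x.1 (d / d₁)),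
          κ (d₁ * x.1) * a₁ (d / d₁ * x.2) := by
  rw [conv_eq_sum_fiber_gcd κ a₁ d l hd]
  exact Finset.sum_congr rfl fun d₁ hd₁ => sum_fiber_gcd_eq κ a₁ hd hl hd₁

/-- `Z22:§7.u042` in the typed shape of slice L2-t5 (`Step7u042 c'`, body unfolded): for Zhang's
`κ` (`Skeleton.kappaZ c' D`). [cite: Zhang2022LandauSiegel, §7 p.39, tex L2074] -/
theorem step7u042 (c' : ℝ) :
    ∀ (D : ℕ) (a₁ : ℕ → ℂ) (d l : ℕ), 0 < d → 0 < l →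
      MeanSquareMajorant.conv (kappaZ c' D) a₁ (d * l) =
        ∑ d₁ ∈ d.divisors,
          ∑ x ∈ (d * l).divisorsAntidiagonal.filter (fun x => Nat.gcd x.1 d = d₁),
            kappaZ c' D x.1 * a₁ x.2 :=
  fun D a₁ d l hd _ => conv_eq_sum_fiber_gcd (kappaZ c' D) a₁ d l hd

/-- `Z22:(7.17)` in the typed shape of slice L2-t5 (`Eq717 c'`, body unfolded): for Zhang's `κ`.
[cite: Zhang2022LandauSiegel, §7 (7.17) p.39, tex L2078] -/
theorem eq717 (c' : ℝ) :
    ∀ (D : ℕ) (a₁ : ℕ → ℂ) (d l : ℕ), 0 < d → 0 < l →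
      MeanSquareMajorant.conv (kappaZ c' D) a₁ (d * l) =
        ∑ d₁ ∈ d.divisors,
          ∑ x ∈ l.divisorsAntidiagonal.filter (fun x => Nat.Coprime x.1 (d / d₁)),
            kappaZ c' D (d₁ * x.1) * a₁ (d / d₁ * x.2) :=
  fun D a₁ d l hd hl => conv_eq_sum_divisors_coprime (kappaZ c' D) a₁ d l hd hl

/-! ## `Z22:§7.u044`: the support clause of (7.2) -/

/-- `Z22:§7.u044` DISCHARGED (typed shape `Step7u044`, body unfolded). "In view of (7.2), we can
assume that `d₂l₂ < PT⁻²`, `d₁d₂k < PT⁻²`" (§7 p. 40): the complementary terms vanish by the support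
clause of (7.2) (`Skeleton.Adm72`). [cite: Zhang2022LandauSiegel, §7 p.40, tex L2097] -/
theorem adm72_support :
    ∀ (D : ℕ) (B : ℝ) (a₁ a₂ : ℕ → ℂ), Adm72 D B a₁ → Adm72 D B a₂ →
      ∀ d₁ d₂ k l₂ : ℕ,
        (bigP D / bigT D ^ 2 ≤ ((d₂ * l₂ : ℕ) : ℝ) → a₁ (d₂ * l₂) = 0) ∧
          (bigP D / bigT D ^ 2 ≤ ((d₁ * d₂ * k : ℕ) : ℝ) → a₂ (d₁ * d₂ * k) = 0) :=
  fun _ _ _ _ ha₁ ha₂ d₁ d₂ k l₂ => ⟨fun h => ha₁.2 (d₂ * l₂) h, fun h => ha₂.2 (d₁ * d₂ * k) h⟩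

/-! ## `Z22:§7.u056`: `λ₀ⱼ(drn) = λ₀ⱼ(dr)λ̃₀ⱼ(n,dr)` -/

/-- `λ(m,s)` at a prime `q` is the single local factor. [cite: Zhang2022LandauSiegel, §7 p.33] -/
theorem lam_prime (c' : ℝ) (D : ℕ) {q : ℕ} (hq : q.Prime) (s : ℂ) :
    lam c' D q s =
      (1 - (q : ℂ) ^ (-(s + beta1 c' D))) * (1 - (q : ℂ) ^ (-(s + beta2 c' D))) *
        (1 - (q : ℂ) ^ (-(s + beta3 c' D))) / (1 - (q : ℂ) ^ (-s)) := by
  rw [lam, hq.primeFactors, Finset.prod_singleton]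

/-- For a prime `q` and `m ≠ 0`: `(q, m) = 1` iff `q` is not a prime factor of `m`. [folklore] -/
private theorem prime_coprime_iff_not_mem_primeFactors {q m : ℕ} (hq : q.Prime) (hm : m ≠ 0) :
    Nat.Coprime q m ↔ q ∉ m.primeFactors := by
  rw [Nat.mem_primeFactors, Nat.Prime.coprime_iff_not_dvd hq]
  tauto

/-- `Z22:§7.u056` DISCHARGED (typed shape `Step7u056 c'`, body unfolded). "Since
`λ₀ⱼ(drn) = λ₀ⱼ(dr)λ̃₀ⱼ(n,dr)`" (§7 p. 41): the prime factors of `drn` are those of `dr` together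
with the prime factors of `n` coprime to `dr` (a disjoint union), and `λ` is a product over prime
factors. [cite: Zhang2022LandauSiegel, §7 p.41, tex L2156] -/
theorem lamZero_mul_eq (c' : ℝ) :
    ∀ (D : ℕ) (j d r n : ℕ), 0 < d → 0 < r → 0 < n →
      lamZero c' D j (d * r * n) = lamZero c' D j (d * r) * lamTildeZero c' D j n (d * r) := by
  intro D j d r n hd hr hn
  have hdr : d * r ≠ 0 := (Nat.mul_pos hd hr).ne'
  set s : ℂ := 1 - betaJ c' D j with hs
  -- the local factor
  set R : ℕ → ℂ := fun q =>
    (1 - (q : ℂ) ^ (-(s + beta1 c' D))) * (1 - (q : ℂ) ^ (-(s + beta2 c' D))) *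
      (1 - (q : ℂ) ^ (-(s + beta3 c' D))) / (1 - (q : ℂ) ^ (-s)) with hR
  have hlam : ∀ m : ℕ, lamZero c' D j m = ∏ q ∈ m.primeFactors, R q := fun m => rfl
  have htilde : lamTildeZero c' D j n (d * r) =
      ∏ q ∈ n.primeFactors \ (d * r).primeFactors, R q := by
    unfold lamTildeZero
    have hset : n.primeFactors.filter (fun q => Nat.Coprime q (d * r)) =
        n.primeFactors \ (d * r).primeFactors := by
      ext q
      simp only [Finset.mem_filter, Finset.mem_sdiff]
      constructor
      · rintro ⟨hq, hcop⟩
        exact ⟨hq, (prime_coprime_iff_not_mem_primeFactors (Nat.prime_of_mem_primeFactors hq)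
          hdr).mp hcop⟩
      · rintro ⟨hq, hnot⟩
        exact ⟨hq, (prime_coprime_iff_not_mem_primeFactors (Nat.prime_of_mem_primeFactors hq)
          hdr).mpr hnot⟩
    rw [hset]
    refine Finset.prod_congr rfl fun q hq => ?_
    rw [Finset.mem_sdiff] at hq
    rw [lamZero, lam_prime c' D (Nat.prime_of_mem_primeFactors hq.1)]
  rw [htilde, hlam, hlam, Nat.primeFactors_mul hdr hn.ne', ← Finset.union_sdiff_self_eq_union,
    Finset.prod_union Finset.disjoint_sdiff]

/-! ## `Z22:§7.u057`: `λ₀ⱼ(drn)·Σ_{n=d₁k₁,(k₁,r)=1}(…) = λ₀ⱼ(dr)ξ₀ⱼ(n;d,r)` -/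

/-- `Z22:§7.u057` DISCHARGED (typed shape `Step7u057 c'`, body unfolded). "it follows that
`λ₀ⱼ(drn) Σ_{n=d₁k₁, (k₁,r)=1} κ̃₀ⱼ(d₁;drk₁)μ(k₁)k₁^{1−β_j}/φ(k₁) = λ₀ⱼ(dr)ξ₀ⱼ(n;d,r)`" (§7 p. 41):
immediate from `Z22:§7.u056` and the definition of `ξ₀ⱼ` (`Skeleton.xiZero`).
[cite: Zhang2022LandauSiegel, §7 p.41, tex L2160] -/
theorem lamZero_mul_sum_eq_xiZero (c' : ℝ) :
    ∀ (D : ℕ) (j d r n : ℕ), 0 < d → 0 < r → 0 < n →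
      lamZero c' D j (d * r * n) *
          ∑ k₁ ∈ n.divisors.filter (fun k₁ => Nat.Coprime k₁ r),
            kappaTildeZero c' D j (n / k₁) (d * r * k₁) * (moebius k₁ : ℂ) *
              (k₁ : ℂ) ^ (1 - betaJ c' D j) / (Nat.totient k₁ : ℂ) =
        lamZero c' D j (d * r) * xiZero c' D j n d r := by
  intro D j d r n hd hr hn
  rw [lamZero_mul_eq c' D j d r n hd hr hn, mul_assoc]
  rfl

end Literature.NumberTheory.LFunctions.Zhang2022.Section7MainTerm
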